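import Literature.Computability.QuantumComplexity.StabilizerRank
import Literature.Computability.QuantumComplexity.QubitRouting
import HarnessLib

/-!
# Wire permutations are Clifford circuits; stabilizer states are closed under them

Topic `Literature/Computability/QuantumComplexity`. Small companion to `StabilizerRank.lean`
(operational stabilizer states: `stabilizerStates n` = the orbit of `|0ⁿ⟩` under the monoid
`cliffordCircuits n` generated by placements of `H`, `S`, `CNOT`) and to the wire permutations
`permGate π : |y⟩ ↦ |y ∘ π⁻¹⟩` of `ForrelationThm25Sign.lean`:

* `permGate_mulVec_apply` — `(P_π ψ)(x) = ψ(x ∘ π)`;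
* `permGate_swap_mem_cliffordCircuits` — a transposition of two wires is a Clifford circuit,
  because `SWAP = CNOT · CNOT' · CNOT` (`swapLayer_eq_cnot_mul`, `QubitRouting.lean`;
  Nielsen–Chuang §1.3.4) and `CNOT'` placed on `(p, q)` is `CNOT` placed on `(q, p)`;
* `permGate_mem_cliffordCircuits` — hence every wire permutation is a Clifford circuit
  (transpositions generate the symmetric group, `Equiv.Perm.swap_induction_on`, and
  `P_π P_ρ = P_{ρ ≫ π}`);
* `comp_perm_mem_stabilizerStates` — stabilizer states are closed under relabelling the wires,
  `ψ ∈ Stab_n → (x ↦ ψ (x ∘ π)) ∈ Stab_n`.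

These are used by the magic semiring (`MagicSemiring.lean`: commutativity of `⊗` up to Clifford
SWAP networks) and by the identification of its rank function with the stabilizer rank.

## References

* M. A. Nielsen, I. L. Chuang, *Quantum Computation and Quantum Information*, CUP 2010, §1.3.4
  (the swap from three CNOTs), §10.5.2 (the Clifford group is generated by `H`, `S`, `CNOT`).
* S. Aaronson, D. Gottesman, *Improved simulation of stabilizer circuits*, Phys. Rev. A 70 (2004)
  052328, §I (stabilizer states = Clifford circuits applied to `|0ⁿ⟩`).
-/

noncomputable section

namespace Literature.Computability.QuantumComplexity

open Cryptography Matrix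

variable {n : ℕ}

/-- `(P_π ψ)(x) = ψ(x ∘ π)`: a wire permutation relabels the argument of a state vector.
[cite: NielsenChuang2010, §1.3.4] -/
theorem permGate_mulVec_apply (π : Equiv.Perm (Fin n)) (ψ : QReg n → ℂ) (x : QReg n) :
    (permGate π *ᵥ ψ) x = ψ (x ∘ π) := by
  rw [Matrix.mulVec, dotProduct, Finset.sum_eq_single (x ∘ π)]
  · rw [permGate_apply, if_pos rfl, one_mul]
  · intro y _ hy
    rw [permGate_apply, if_neg hy, zero_mul]
  · intro h
    exact absurd (Finset.mem_univ _) h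

/-- As a function, `P_π ψ = ψ ∘ (· ∘ π)`. [cite: NielsenChuang2010, §1.3.4] -/
theorem permGate_mulVec_eq (π : Equiv.Perm (Fin n)) (ψ : QReg n → ℂ) :
    permGate π *ᵥ ψ = fun x => ψ (x ∘ π) :=
  funext fun x => permGate_mulVec_apply π ψ x

/-- A placed `CNOT` is a Clifford circuit. [cite: AaronsonGottesman2004, §I] -/
theorem placeGate_cnot_mem_cliffordCircuits (e : Fin 2 ↪ Fin n) :
    placeGate e cnot ∈ cliffordCircuits n :=
  Submonoid.subset_closure ⟨CliffordOp.CNOT, e, rfl⟩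

/-- **A transposition of two wires is a Clifford circuit**: `SWAP_{pq} = CNOT_{pq} CNOT_{qp} CNOT_{pq}`.
[cite: NielsenChuang2010, §1.3.4] -/
theorem permGate_swap_mem_cliffordCircuits (p q : Fin n) :
    permGate (Equiv.swap p q) ∈ cliffordCircuits n := by
  by_cases h : p = q
  · subst h
    rw [Equiv.swap_self, permGate_refl]
    exact Submonoid.one_mem _
  · rw [← placeGate_pairEmb_swapLayer p q h, swapLayer_eq_cnot_mul, placeGate_mul_holds,
      placeGate_mul_holds, placeGate_pairEmb_cnot' h]
    exact Submonoid.mul_mem _ (Submonoid.mul_mem _ (placeGate_cnot_mem_cliffordCircuits _)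
      (placeGate_cnot_mem_cliffordCircuits _)) (placeGate_cnot_mem_cliffordCircuits _)

/-- **Every wire permutation is a Clifford circuit** (transpositions generate the symmetric group).
[cite: NielsenChuang2010, §1.3.4] -/
theorem permGate_mem_cliffordCircuits (π : Equiv.Perm (Fin n)) : permGate π ∈ cliffordCircuits n := by
  induction π using Equiv.Perm.swap_induction_on with
  | one =>
    change permGate (Equiv.refl (Fin n)) ∈ cliffordCircuits n
    rw [permGate_refl]
    exact Submonoid.one_mem _
  | swap_mul f x y _ ih =>
    rw [Equiv.Perm.mul_def, ← permGate_mul_permGate]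
    exact Submonoid.mul_mem _ (permGate_swap_mem_cliffordCircuits x y) ih

/-- Stabilizer states are closed under wire permutations (as operators). [cite: AaronsonGottesman2004, §I] -/
theorem permGate_mulVec_mem_stabilizerStates (π : Equiv.Perm (Fin n)) {ψ : QReg n → ℂ}
    (hψ : ψ ∈ stabilizerStates n) : permGate π *ᵥ ψ ∈ stabilizerStates n :=
  mulVec_mem_stabilizerStates (permGate_mem_cliffordCircuits π) hψ

/-- **Stabilizer states are closed under relabelling the wires**: if `ψ` is a stabilizer state
then so is `x ↦ ψ (x ∘ π)` for every permutation `π` of the wires. [cite: AaronsonGottesman2004, §I] -/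
theorem comp_perm_mem_stabilizerStates (π : Equiv.Perm (Fin n)) {ψ : QReg n → ℂ}
    (hψ : ψ ∈ stabilizerStates n) : (fun x => ψ (x ∘ π)) ∈ stabilizerStates n := by
  rw [← permGate_mulVec_eq]
  exact permGate_mulVec_mem_stabilizerStates π hψ

/-- `|0ⁿ⟩` relabelled is `|0ⁿ⟩`. [folklore] -/
theorem zeroState_comp_perm (π : Equiv.Perm (Fin n)) (x : QReg n) :
    zeroState n (x ∘ π) = zeroState n x := by
  have h := permGate_mulVec_apply π (zeroState n) x
  rw [zeroState, permGate_mulVec_zero] at h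
  exact h.symm

end Literature.Computability.QuantumComplexity
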